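import Summits.CriticalPhenomena.PercolationContinuityZ3.Theorems.PercAnnulusCrossingIICNearCriticalLimit
import Summits.CriticalPhenomena.PercolationContinuityZ3.Theorems.PercAnnulusCrossingMetricToBoxRendering
import Summits.CriticalPhenomena.PercolationContinuityZ3.Theorems.PercAnnulusCrossingOneArmQuasiMultDoubling
import Summits.CriticalPhenomena.PercolationContinuityZ3.Theorems.SoloInformedAnnulusEntrance
import HarnessLib

/-!
# Basu–Sapozhnikov's Theorem 1.1 for `ℤ^d` with the PRINTED hypothesis (A2)_ρ on `[p_c, q]` — NEAR-CRITICAL series XIV (lane RSW3, p1 gen 6)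

builds on p205010 (kernel theorem, internal audit signed; external expert review pending) — not used by this file's theorems.

Seat `prim-rsw3-p1` (gen 6).  The lane's one-way rendering of the printed graph-metric (A2)_ρ into the box form (A2)□ at aspect `(4d, 16d²)`
(`setToSetQuasiMultAspectAt_of_basuSapozhnikovQM`, V67) is stated at `p_c` only, because its window step uses the critical annulus window
`Rsw3.le_real_boxCrossing_criticalProbI_of_le`.  For `p ≥ p_c` that window is inherited by monotonicity (the annulus crossing is increasing), so
the rendering holds at every `p ≥ p_c`; feeding series XII gives KESTEN'S SECOND CONSTRUCTION under Basu–Sapozhnikov's hypothesis AS PRINTED: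
(A2) in the graph metric of `ℤ^d` with one constant on `[p_c, q]`.  Helper file; no definitions, no sorries.
* `setToSetQM_fixedAspect_of_setToSetQM'_of_le` — p219928's fixed-aspect reduction `(A2′)_l ⇒ (A2)□ at (l, l²)` at every `p ≥ p_c`;
* `setToSetQuasiMultAspectAt_of_basuSapozhnikovQM_of_le` — (A2)_ρ at `p ≥ p_c` ⇒ (A2)□ at aspect `(4d, 16d²)` at `p`;
* **`kesten_iic_eq_lim_condPercolation_of_basuSapozhnikovQM`**, **`exists_iicMeasure_tendsto_cond_percolatesAt_of_basuSapozhnikovQM`** —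
  `d ≥ 2`, `ϰ > 0`, `p_c < q < 1`, `BasuSapozhnikovQM (zdGraph d) 0 p ϰ` for all `p ∈ [p_c, q]` ⇒ `lim_n P_{p_c}(E | 0 ↔ ∂ⁱⁿΛ(n)) =
  lim_{p↓p_c} P_p(E | |C(0)| = ∞)` for every cylinder `E`, both limits existing, with ONE IIC probability measure.
References: D. Basu, A. Sapozhnikov, ECP 22 (2017) no. 26, Thm. 1.1, §1 (A2), §3 eqs. (13)–(14); H. Kesten, PTRF 73 (1986), Thm. (3).
-/

noncomputable section

namespace Summit.CriticalPhenomena.PercolationContinuityZ3.Theorems.Crossing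

open MeasureTheory ProbabilityTheory Filter Topology Literature.Probability.Percolation Literature.Probability.LatticeModels
open Literature.Probability.Percolation.DCT16 Literature.Probability.Percolation.DKT20
open Summit.CriticalPhenomena.PercolationContinuityZ3.Theorems.SurfaceTension
open scoped Literature.Probability.Percolation ProbabilityTheory

variable {d : ℕ}

/-! ## The fixed-aspect reduction at every `p ≥ p_c` -/

/-- **(A2′) at aspect `l` ⇒ (A2)□ at aspect `(l, l²)`, at every `p ≥ p_c(ℤ^d)`** (`d ≥ 2`, `l ≥ 2`, `c ≥ 0`): p219928's
`setToSetQM_fixedAspect_of_setToSetQM'` verbatim, the critical annulus window being inherited at `p ≥ p_c` by monotonicity of the increasing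
event `boxCrossing d m (l²m)`. [cite: BasuSapozhnikov2017ECP, §3 eqs. (13)–(14)] -/
theorem setToSetQM_fixedAspect_of_setToSetQM'_of_le (hd : 2 ≤ d) {p : unitInterval} (hpc : criticalProbI d ≤ p) {l : ℕ} (hl : 2 ≤ l)
    {c : ℝ} (hc : 0 ≤ c)
    (hA2' : ∀ a : ℕ, 1 ≤ a → ∀ Z : Finset (Site d), box d (l * a) \ box d (a - 1) ⊆ Z →
      ∀ X : Finset (Site d), X ⊆ Z ∩ box d a → ∀ Y : Finset (Site d), Y ⊆ Z \ box d (l * a) →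
        c * (bondPercolation (zdGraph d) p).real
              {ω | ∃ x ∈ X, ∃ s ∈ innerBoundary (zdGraph d) (box d (l * a)), ω ∈ openConnIn (↑Z : Set (Site d)) x s} *
            (bondPercolation (zdGraph d) p).real
              {ω | ∃ y ∈ Y, ∃ s ∈ innerBoundary (zdGraph d) (box d a), ω ∈ openConnIn (↑Z : Set (Site d)) y s} ≤
          (bondPercolation (zdGraph d) p).real
            {ω | ∃ x ∈ X, ∃ y ∈ Y, ω ∈ openConnIn (↑Z : Set (Site d)) x y}) :
    ∀ m : ℕ, 1 ≤ m → ∀ Z : Finset (Site d), box d (l * (l * m)) \ box d (m - 1) ⊆ Z →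
      ∀ X : Finset (Site d), X ⊆ Z ∩ box d m → ∀ Y : Finset (Site d), Y ⊆ Z \ box d (l * (l * m)) →
        c ^ 2 * ((2 * (d : ℝ))⁻¹ * ((1 : ℝ) / (4 * ((l : ℝ) * l))) ^ (d - 1)) *
            ((bondPercolation (zdGraph d) p).real {ω | ∃ x ∈ X,
                ∃ s ∈ innerBoundary (zdGraph d) (box d (l * m)), ω ∈ openConnIn (↑Z : Set (Site d)) x s} *
              (bondPercolation (zdGraph d) p).real {ω | ∃ y ∈ Y,
                ∃ s ∈ innerBoundary (zdGraph d) (box d (l * m)), ω ∈ openConnIn (↑Z : Set (Site d)) y s}) ≤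
          (bondPercolation (zdGraph d) p).real {ω | ∃ x ∈ X, ∃ y ∈ Y,
                ω ∈ openConnIn (↑Z : Set (Site d)) x y} := by
  intro m hm Z hZ X hX Y hY
  have hl1 : 1 ≤ l := by omega
  have hlm : m ≤ l * m := Nat.le_mul_of_pos_left m (by omega)
  have hlm' : l * m < l * (l * m) := by nlinarith
  have hmlm : m < l * (l * m) := lt_of_le_of_lt hlm hlm'
  set μ := bondPercolation (zdGraph d) p with hμ
  set w : ℝ := (2 * (d : ℝ))⁻¹ * ((1 : ℝ) / (4 * ((l : ℝ) * l))) ^ (d - 1) with hw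
  set PX1 := μ.real {ω | ∃ x ∈ X, ∃ s ∈ innerBoundary (zdGraph d) (box d (l * m)), ω ∈ openConnIn (↑Z : Set (Site d)) x s}
  set PX2 := μ.real {ω | ∃ x ∈ X, ∃ s ∈ innerBoundary (zdGraph d) (box d (l * (l * m))), ω ∈ openConnIn (↑Z : Set (Site d)) x s}
  set PY1 := μ.real {ω | ∃ y ∈ Y, ∃ s ∈ innerBoundary (zdGraph d) (box d (l * m)), ω ∈ openConnIn (↑Z : Set (Site d)) y s}
  set P21 := μ.real {ω | ∃ y ∈ innerBoundary (zdGraph d) (box d (l * (l * m))),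
    ∃ s ∈ innerBoundary (zdGraph d) (box d m), ω ∈ openConnIn (↑Z : Set (Site d)) y s}
  set PXY := μ.real {ω | ∃ x ∈ X, ∃ y ∈ Y, ω ∈ openConnIn (↑Z : Set (Site d)) x y}
  -- (A2′) at `(lm, l²m)`
  have hZ2 : box d (l * (l * m)) \ box d (l * m - 1) ⊆ Z :=
    (Finset.sdiff_subset_sdiff le_rfl (box_mono d (by omega))).trans hZ
  have hX2 : X ⊆ Z ∩ box d (l * m) := hX.trans (Finset.inter_subset_inter le_rfl (box_mono d hlm))
  have h1 : c * PX2 * PY1 ≤ PXY := hA2' (l * m) (by omega) Z hZ2 X hX2 Y hY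
  -- (A2′) at `(m, lm)` with target `∂ⁱⁿΛ(l²m)`
  have hZ1 : box d (l * m) \ box d (m - 1) ⊆ Z :=
    (Finset.sdiff_subset_sdiff (box_mono d hlm'.le) le_rfl).trans hZ
  have hS : innerBoundary (zdGraph d) (box d (l * (l * m))) ⊆ Z \ box d (l * m) := by
    intro s hs
    refine Finset.mem_sdiff.2 ⟨hZ (Finset.mem_sdiff.2 ⟨(Finset.mem_filter.1 hs).1, ?_⟩),
      notMem_box_of_mem_innerBoundary_box hlm' hs⟩
    exact notMem_box_of_mem_innerBoundary_box (by omega) hs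
  have h2 : c * PX1 * P21 ≤ PX2 := hA2' m hm Z hZ1 X hX (innerBoundary (zdGraph d) (box d (l * (l * m)))) hS
  -- the window at `p_c`, transported to `p ≥ p_c` by monotonicity
  have h3 : w ≤ P21 := by
    have hwin := Rsw3.le_real_boxCrossing_criticalProbI_of_le hd hm hmlm.le
    have heq : ((m : ℝ) / (4 * ((l * (l * m) : ℕ) : ℝ))) = (1 : ℝ) / (4 * ((l : ℝ) * l)) := by
      have hm0 : (m : ℝ) ≠ 0 := by exact_mod_cast (by omega : m ≠ 0)
      have hl0 : (l : ℝ) ≠ 0 := by exact_mod_cast (by omega : l ≠ 0)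
      push_cast
      field_simp
    rw [heq] at hwin
    have hmono : (bondPercolation (zdGraph d) (criticalProbI d)).real (boxCrossing d m (l * (l * m))) ≤
        μ.real (boxCrossing d m (l * (l * m))) :=
      real_mono_of_isUpperSet (zdGraph d) (isUpperSet_boxCrossing m (l * (l * m))) (measurableSet_boxCrossing m (l * (l * m))) hpc
    exact (hwin.trans hmono).trans (real_boxCrossing_le_real_link_spheres_of_le p hm hmlm.le hZ)
  -- combine
  have hPX1 : 0 ≤ PX1 := measureReal_nonneg
  have hPY1 : 0 ≤ PY1 := measureReal_nonneg
  have hP21 : 0 ≤ P21 := measureReal_nonneg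
  have hw0 : 0 ≤ w := by positivity
  calc c ^ 2 * w * (PX1 * PY1) = c * (c * PX1 * w) * PY1 := by ring
    _ ≤ c * (c * PX1 * P21) * PY1 := by
        have : c * PX1 * w ≤ c * PX1 * P21 := mul_le_mul_of_nonneg_left h3 (mul_nonneg hc hPX1)
        exact mul_le_mul_of_nonneg_right (mul_le_mul_of_nonneg_left this hc) hPY1
    _ ≤ c * PX2 * PY1 := mul_le_mul_of_nonneg_right (mul_le_mul_of_nonneg_left h2 hc) hPY1
    _ ≤ PXY := h1

/-- **The PRINTED (A2)_ρ at `p ≥ p_c(ℤ^d)` feeds the box form at `p`**: Basu–Sapozhnikov's graph-metric (A2) with constant `ϰ ≥ 0` at a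
density `p ≥ p_c` implies `SetToSetQuasiMultAspectAt d p (4d) (16d²) (ϰ²·(2d)⁻¹·(1/(64d²))^{d−1})` (`setToSetQM'_fourMul_of_basuSapozhnikovQM`,
every `p`, + the fixed-aspect reduction at `p ≥ p_c`). [cite: BasuSapozhnikov2017ECP, §1 assumption (A2)] -/
theorem setToSetQuasiMultAspectAt_of_basuSapozhnikovQM_of_le (hd : 2 ≤ d) {p : unitInterval} (hpc : criticalProbI d ≤ p)
    {ϰ : ℝ} (hϰ : 0 ≤ ϰ) (hBS : BasuSapozhnikovQM (zdGraph d) (0 : Site d) p ϰ) :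
    SetToSetQuasiMultAspectAt d p (4 * d) (4 * d * (4 * d))
      (ϰ ^ 2 * ((2 * (d : ℝ))⁻¹ * ((1 : ℝ) / (4 * (((4 * d : ℕ) : ℝ) * ((4 * d : ℕ) : ℝ)))) ^ (d - 1))) := by
  intro m hm Z hZ X hX Y hY
  have hl : 2 ≤ 4 * d := by omega
  have hA2' := setToSetQM'_fourMul_of_basuSapozhnikovQM hd hBS
  have key := setToSetQM_fixedAspect_of_setToSetQM'_of_le hd hpc hl hϰ hA2' m hm Z
    (by rw [← Nat.mul_assoc]; exact hZ) X hX Y (by rw [← Nat.mul_assoc]; exact hY)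
  exact key

/-! ## Basu–Sapozhnikov's Theorem 1.1 for `ℤ^d`, printed hypothesis -/

/-- **KESTEN'S SECOND CONSTRUCTION under the PRINTED (A2)_ρ on `[p_c, q]`** (`d ≥ 2`, `ϰ > 0`, `p_c < q < 1`): if Basu–Sapozhnikov's
graph-metric quasi-multiplicativity `BasuSapozhnikovQM (zdGraph d) 0 p ϰ` holds for every `p ∈ [p_c, q]`, then for every cylinder event `E`,
`ν(E) := lim_n P_{p_c}(E | 0 ↔ ∂ⁱⁿΛ(n))` exists and `P_p(E ∩ {|C(0)| = ∞})/θ(p) → ν(E)` as `p ↓ p_c` — their Theorem 1.1 for `G = ℤ^d`, `v = w = 0`,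
(A1) from the tree. [cite: BasuSapozhnikov2017ECP, Thm. 1.1] [cite: Kesten1986, Thm. (3)] -/
theorem kesten_iic_eq_lim_condPercolation_of_basuSapozhnikovQM (hd : 2 ≤ d) {ϰ : ℝ} (hϰ : 0 < ϰ)
    {q : unitInterval} (hq : criticalProbI d < q) (hq1 : (q : ℝ) < 1)
    (hBS : ∀ p : unitInterval, criticalProbI d ≤ p → p ≤ q → BasuSapozhnikovQM (zdGraph d) (0 : Site d) p ϰ)
    (F : Finset (Sym2 (Site d))) (E : Set (BondConfig (Site d))) (hEm : MeasurableSet E) (hEF : DeterminedBy E ↑F) :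
    ∃ ν : ℝ,
      Tendsto (fun n : ℕ => (bondPercolation (zdGraph d) (criticalProbI d)).real (E ∩ siteToBoundary d n) / oneArmProb d (criticalProbI d) n)
        atTop (𝓝 ν) ∧
      Tendsto (fun p : unitInterval => (bondPercolation (zdGraph d) p).real (E ∩ percolatesAt (0 : Site d)) / theta (zdGraph d) (0 : Site d) p)
        (𝓝[>] (criticalProbI d)) (𝓝 ν) := by
  have hd1 : 1 ≤ d := by omega
  exact kesten_iic_eq_lim_condPercolation_of_setToSetQuasiMultAspectAt hd (s := 4 * d) (L := 4 * d * (4 * d)) (by omega)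
    (by positivity) hq hq1 (fun p h1 h2 => setToSetQuasiMultAspectAt_of_basuSapozhnikovQM_of_le hd h1 hϰ.le (hBS p h1 h2)) F E hEm hEF

/-- **Measure form**: under the printed (A2)_ρ on `[p_c, q]` there is ONE probability measure `ν` — Kesten's IIC of `ℤ^d` at `p_c` — with
`P_{p_c}(E | 0 ↔ ∂ⁱⁿΛ(n)) → ν(E)` and `P_p[E | {|C(0)| = ∞}] → ν(E)` (`p ↓ p_c`) for every cylinder event `E`: both constructions of Kesten's
Theorem (3) agree. [cite: BasuSapozhnikov2017ECP, Thm. 1.1] [cite: Kesten1986, Thm. (3)] -/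
theorem exists_iicMeasure_tendsto_cond_percolatesAt_of_basuSapozhnikovQM (hd : 2 ≤ d) {ϰ : ℝ} (hϰ : 0 < ϰ)
    {q : unitInterval} (hq : criticalProbI d < q) (hq1 : (q : ℝ) < 1)
    (hBS : ∀ p : unitInterval, criticalProbI d ≤ p → p ≤ q → BasuSapozhnikovQM (zdGraph d) (0 : Site d) p ϰ) :
    ∃ ν : Measure (BondConfig (Site d)), IsProbabilityMeasure ν ∧
      (∀ (F : Finset (Sym2 (Site d))) (E : Set (BondConfig (Site d))), MeasurableSet E → DeterminedBy E ↑F →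
        Tendsto (fun n : ℕ => (bondPercolation (zdGraph d) (criticalProbI d)).real (E ∩ siteToBoundary d n) / oneArmProb d (criticalProbI d) n)
          atTop (𝓝 (ν.real E))) ∧
      (∀ (F : Finset (Sym2 (Site d))) (E : Set (BondConfig (Site d))), MeasurableSet E → DeterminedBy E ↑F →
        Tendsto (fun p : unitInterval => ((bondPercolation (zdGraph d) p)[|percolatesAt (0 : Site d)]).real E)
          (𝓝[>] (criticalProbI d)) (𝓝 (ν.real E))) := by
  have hd1 : 1 ≤ d := by omega
  exact exists_iicMeasure_tendsto_cond_percolatesAt_of_setToSetQuasiMultAspectAt hd (s := 4 * d) (L := 4 * d * (4 * d)) (by omega)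
    (by positivity) hq hq1 (fun p h1 h2 => setToSetQuasiMultAspectAt_of_basuSapozhnikovQM_of_le hd h1 hϰ.le (hBS p h1 h2))

end Summit.CriticalPhenomena.PercolationContinuityZ3.Theorems.Crossing

end
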